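import Summits.Ventures.QEC.CircuitDistance.PortK2DataBB144Z
import Summits.Ventures.QEC.CircuitDistance.K2Chunks
import HarnessLib

/-!
# K2(`[[144,12,12]]`) chunk module — COMPUTATIONAL (native_decide; `Lean.ofReduceBool`)

Cell `qec`, CDX, R146/R152 STEP 1 («computational» header; `ofReduceBool` confined to these chunk modules). Checker of record
`K2.K2Data` (qec-cdx-type-1, PortK2Check); data module of record `PortK2DataBB144X/Z` (p669158/9, crit-1 data audit PASS
2026-08-28T21:20Z); chunk glue `K2Chunks` (idea-1 g2). Cube 0, child 17: leaf group 5 of 6.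
Leaf theorems: the K2 DFS accepts below one descendant state of pivot cube 0 (sector Z); sizes are exact DFS visit counts
(eng-1 g2 `k2count.c`), capped so that the gate's native-axiom audit re-verifies every leaf in place. Assemblies re-derive the
child lists in the kernel (`decide`) and end in the literal cube fact `d144Z.cube (Ts144Z.getD 0 []) (0) (lives144Z.getD 0 0) = true`
(the `hcubes` hypothesis of `K2Inst.k2_complete`). Emitted by qec-cdx-eng-1 g2 (`gen2.py`, idea-1's `gen_k2chunks_from_lean.py` lineage).
-/

namespace Summit.Ventures.QEC.CircuitDistance.K2

set_option maxRecDepth 100000 in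
set_option maxHeartbeats 0 in
set_option exponentiation.threshold 1024 in
/-- K2(144) chunk fact `cube144Z0_ch17_12` (448364 DFS visits; see the module docstring). -/
theorem cube144Z0_ch17_12 : app5 (d144Z.dfs (Ts144Z.getD 0 []) 6) (2951542665138264867456, 424, 1018517988167243043134236324178022655845631530340511635133407043249401920167908904896823297, 3, 2348542582773833226868973315676453000151437963337165943121587187285002582559956562596250383920728906869506012) = true := by native_decide

set_option maxRecDepth 100000 in
set_option maxHeartbeats 0 in
set_option exponentiation.threshold 1024 in
/-- K2(144) chunk fact `cube144Z0_ch17_13` (357900 DFS visits; see the module docstring). -/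
theorem cube144Z0_ch17_13 : app5 (d144Z.dfs (Ts144Z.getD 0 []) 6) (592664703762702567552, 2538, 1018517988167243043135085562498037900999163541315752753499626613298711948201063668619673601, 3, 2348542582773833226868973315676453000150575245043817122648157842802217954378400173974729085601333591341531100) = true := by native_decide

set_option maxRecDepth 100000 in
set_option maxHeartbeats 0 in
set_option exponentiation.threshold 1024 in
/-- K2(144) chunk fact `cube144Z0_ch17_14` (502219 DFS visits; see the module docstring). -/
theorem cube144Z0_ch17_14 : app5 (d144Z.dfs (Ts144Z.getD 0 []) 6) (2951506073391328166016, 1484, 1018517988167243099673328917112987627191254220606360631797554924696997309773066794455531521, 3, 2348542582773833226868973315676452943611469172135518575982637819028825447898915473954922425709935149977698268) = true := by native_decide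

set_option maxRecDepth 100000 in
set_option maxHeartbeats 0 in
set_option exponentiation.threshold 1024 in
/-- K2(144) chunk fact `cube144Z0_ch17_15` (379857 DFS visits; see the module docstring). -/
theorem cube144Z0_ch17_15 : app5 (d144Z.dfs (Ts144Z.getD 0 []) 6) (590322831958753675392, 3528, 1018517988167246661637011510335796067119015718330088540005091025944816882931168600376999937, 3, 2348542582773833226868973315676449325108680506004411589389356297531705033211894672687296192660434902692397020) = true := by native_decide
end Summit.Ventures.QEC.CircuitDistance.K2
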